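import Summits.BirchSwinnertonDyer.BirchSwinnertonDyer.Theorems.EisensteinPrimesBSDpOnCellCTelescopeBranchLatticeOfFramed
import HarnessLib

/-!
# [telescope — width x2-p2 g23, 2026-08-30] LEAF N1 FROM FRAMED LATTICE DATA IN WEIERSTRASS-REMAINDER CURRENCY («N1♭-rem»): the member fibre
# clause (fd_k♭) stated as `ρ σ = C(M σ) + (X − C x_k)·U σ` with an isogeny intertwining `M` — the exact shape of (G-fib_t) in the cell's Galois
# fact text T-GAL (ideator bsd-idea-12 g41, `Cruxes/BSDpOnCellC/T-GAL-FACTTEXT.md` §3a) — no evaluation homomorphism `φ` needed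
# Crux 4 `BSDpOnCellC` (stmt-BirchSwinnertonDyer-19034), line «telescope», leaf N1 `stub_branchLattice` (`--supports`, helper; closes nothing)

WHY: #3 `TelescopeBranchLatticeOfFramed.branchLattice_of_framed` reduces the registered `stub_branchLattice` to framed lattice data N1♭ whose
member clause reads the fibre through a `ℤ_p`-point `φ` (`φ X = x_k`). The Galois fact the cell is typing (T-An-2ᵍ / `IsBranchGaloisLattice`, g41)
states the member fibre in WEIERSTRASS-REMAINDER form — «`ρ σ = (M σ).map C + (X − C x_t) • U σ`, `M σ` conjugate to the member's self-dual
datum». This file is the same reduction in that currency: §1 `matrixAction_apply_apply_of_eq_map_C_add`, §2 `exists_fibreMap_rem`, §3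
**`branchLattice_conclusion_of_framed_rem`** (prefix-agnostic: N1's v13c CONCLUSION l.440–473 token for token) and **`branchLattice_of_framed_rem`**
(ON THE REGISTERED TEXT, v13c l.400–473 token for token). With g41's H2 (rational conjugacy ⟹ integral intertwiner) and this seat's #4
(`TelescopeBranchIsogenyOfIntertwiner`: integral intertwiner ⟹ isogeny of `(ℚ_p/ℤ_p)²`) the (G-fib_t) clause of T-GAL feeds (fd_k♭-rem) up to
the target identification `(ℚ_p/ℤ_p)² ≃ A_{g_k}†` (under (rat_k)).

HONEST FRAMING: a by-name reduction; constructs no Hida family; N1♭-rem is NOT proved; closes no registered stub, no crux, no summit statement;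
BSD is proved for no curve by this file. THEOREMS ONLY: no definition, no named fact, no instance, no `sorry`.
References (shape only): [cite: Hida1986, Thm. 2.1 (2.2b) (2.2c)] [cite: Wiles1988, §2] [cite: Greenberg2006, p. 342 L4–11]
-/

set_option autoImplicit false
set_option linter.dupNamespace false

noncomputable section

open scoped Classical MatrixGroups ModularForm
open CongruenceSubgroup WeierstrassCurve NumberField IsDedekindDomain Field PowerSeries Finset
  Literature.NumberTheory.EllipticCurves Literature.NumberTheory.EllipticCurves.GreenbergSelmer
  Literature.NumberTheory.EllipticCurves.ModularForms Literature.NumberTheory.QuadraticFields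
  Literature.NumberTheory.EllipticCurves.Rank1Residual
  Literature.NumberTheory.EllipticCurves.Rank1Residual.Typed
  Literature.NumberTheory.GaloisRepresentations Literature.NumberTheory.GaloisCohomology
  Literature.NumberTheory.IwasawaTheory Literature.NumberTheory.IwasawaTheory.Greenberg2016
  Summit.BirchSwinnertonDyer.Rank1Residual.X11b.AcSelmer
  Summit.BirchSwinnertonDyer.Rank1Residual.X11b.Halves
  Summit.BirchSwinnertonDyer.Rank1Residual.X11b
  Summit.BirchSwinnertonDyer.Rank1Residual Summit.BirchSwinnertonDyer.Rank1Residual.X1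
  Summit.BirchSwinnertonDyer.Rank1Residual.X2
open Literature.NumberTheory.EllipticCurves.BigGaloisRep Literature.NumberTheory.EllipticCurves.Castella2018
open Summit.BirchSwinnertonDyer.BirchSwinnertonDyer.Theorems
  Summit.BirchSwinnertonDyer.BirchSwinnertonDyer.Theorems.TelescopeBranchLatticeOfFramed
  Summit.BirchSwinnertonDyer.BirchSwinnertonDyer.Theorems.TelescopeBranchCofreeRealisation
  Summit.BirchSwinnertonDyer.BirchSwinnertonDyer.Theorems.TelescopeBranchCofreeRealisationFibres

namespace Summit.BirchSwinnertonDyer.BirchSwinnertonDyer.Theorems.TelescopeBranchLatticeOfFramedRem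

/-! ## §1 The framed action on a fibre, Weierstrass-remainder currency -/

/-- **On `A₂[X − C c]` a framed matrix written `M.map C + (X − C c) • U` acts through `M`**, pointwise in `x ∈ ℤ_p`: for any `ρ₂` with the
matrix formula of the cofree realisation and `Ψ` with `(X − C c) • Ψ = 0`, `(ρ₂ g Ψ) i x = Σ_j (M i j) • Ψ j x` (the `(X − C c)`-multiple dies on
the fibre, `C m` acts as `m`). [cite: Hida1986, Thm. 2.1 (2.2c)] -/
theorem matrixAction_apply_apply_of_eq_map_C_add {𝒪 : Type*} [CommRing 𝒪] {p : ℕ} [Fact p.Prime] {Q : Type*} [AddCommGroup Q] [Module 𝒪 Q]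
    {n : ℕ} {G : Type*} [Group G] [TopologicalSpace G] [TopologicalSpace (PowerSeries 𝒪)]
    (ρ : G →ₜ* GL (Fin n) (PowerSeries 𝒪)) (ρ₂ : ContinuousRep G (PowerSeries 𝒪) (Fin n → BigRepModule 𝒪 p Q))
    (hρ₂ : ∀ (g : G) (Ψ : Fin n → BigRepModule 𝒪 p Q) (i : Fin n),
      ρ₂ g Ψ i = ∑ j, ((ρ g : GL (Fin n) (PowerSeries 𝒪)) : Matrix (Fin n) (Fin n) (PowerSeries 𝒪)) i j • Ψ j)
    {c : 𝒪} {g : G} {M : Matrix (Fin n) (Fin n) 𝒪} {U : Matrix (Fin n) (Fin n) (PowerSeries 𝒪)}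
    (hM : ((ρ g : GL (Fin n) (PowerSeries 𝒪)) : Matrix (Fin n) (Fin n) (PowerSeries 𝒪)) =
      M.map (PowerSeries.C (R := 𝒪)) + (PowerSeries.X - PowerSeries.C c : PowerSeries 𝒪) • U)
    {Ψ : Fin n → BigRepModule 𝒪 p Q} (hΨ : (PowerSeries.X - PowerSeries.C c : PowerSeries 𝒪) • Ψ = 0) (i : Fin n) (x : ℤ_[p]) :
    ρ₂ g Ψ i x = ∑ j, M i j • Ψ j x := by
  rw [hρ₂, hM, BigRepModule.finset_sum_apply]
  refine Finset.sum_congr rfl fun j _ ↦ ?_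
  rw [Matrix.add_apply, Matrix.map_apply, Matrix.smul_apply, smul_eq_mul, add_smul, mul_comm, mul_smul,
    show (PowerSeries.X - PowerSeries.C c : PowerSeries 𝒪) • Ψ j = 0 from congr_fun hΨ j, smul_zero, add_zero, BigRepModule.C_smul,
    BigRepModule.smul_apply]

/-! ## §2 The fibre map, remainder currency -/

/-- **The fibre map in remainder currency**: as `TelescopeBranchLatticeOfFramed.exists_fibreMap`, but the fibre at `c` (`p ∣ c`, `r = X − C c`) is
read through a Weierstrass-remainder presentation `ρ σ = (M σ).map C + (X − C c) • U σ` of the framed matrices, and the isogeny `e` intertwines `M`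
(`e (M σ · v) = act σ (e v)`); `θ := e ∘ (a ↦ (a j 0)_j)` on `A₂[r]` is `C`-semilinear, `torsionRep ρ₂ r`-equivariant, with finite kernel and cokernel.
[cite: Hida1986, Thm. 2.1 (2.2c)] [cite: Greenberg2006, p. 342 L4–11] -/
theorem exists_fibreMap_rem {p : ℕ} [Fact p.Prime] {n : ℕ} {G : Type} [Group G] [TopologicalSpace G]
    [TopologicalSpace (PowerSeries ℤ_[p])]
    (ρ : G →ₜ* GL (Fin n) (PowerSeries ℤ_[p]))
    (ρ₂ : ContinuousRep G (PowerSeries ℤ_[p]) (Fin n → BigRepModule ℤ_[p] p (QpModZp p)))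
    (hρ₂ : ∀ (g : G) (Ψ : Fin n → BigRepModule ℤ_[p] p (QpModZp p)) (i : Fin n),
      ρ₂ g Ψ i = ∑ j, ((ρ g : GL (Fin n) (PowerSeries ℤ_[p])) : Matrix (Fin n) (Fin n) (PowerSeries ℤ_[p])) i j • Ψ j)
    {c : ℤ_[p]} (hc : (p : ℤ_[p]) ∣ c) {r : PowerSeries ℤ_[p]} (hr : r = PowerSeries.X - PowerSeries.C c)
    (M : G → Matrix (Fin n) (Fin n) ℤ_[p]) (U : G → Matrix (Fin n) (Fin n) (PowerSeries ℤ_[p]))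
    (hM : ∀ σ : G, ((ρ σ : GL (Fin n) (PowerSeries ℤ_[p])) : Matrix (Fin n) (Fin n) (PowerSeries ℤ_[p])) =
      (M σ).map (PowerSeries.C (R := ℤ_[p])) + (PowerSeries.X - PowerSeries.C c : PowerSeries ℤ_[p]) • U σ)
    {T : Type*} [AddCommGroup T] (sm : ℤ_[p] → T → T) (act : G → T → T) (e : (Fin n → QpModZp p) →+ T)
    (he_lin : ∀ (c : ℤ_[p]) (v : Fin n → QpModZp p), e (c • v) = sm c (e v))
    (he_eq : ∀ (σ : G) (v : Fin n → QpModZp p),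
      e (fun i ↦ ∑ j, M σ i j • v j) = act σ (e v))
    (hker : Finite e.ker) (hcoker : Finite (T ⧸ e.range)) :
    ∃ θ : Submodule.torsionBy (PowerSeries ℤ_[p]) (Fin n → BigRepModule ℤ_[p] p (QpModZp p)) r →+ T,
      (∀ (c : ℤ_[p]) (a : Submodule.torsionBy (PowerSeries ℤ_[p]) (Fin n → BigRepModule ℤ_[p] p (QpModZp p)) r),
          θ (PowerSeries.C c • a) = sm c (θ a)) ∧
      (∀ (σ : G) (a : Submodule.torsionBy (PowerSeries ℤ_[p]) (Fin n → BigRepModule ℤ_[p] p (QpModZp p)) r),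
          θ (BigGaloisRep.torsionRep ρ₂ r σ a) = act σ (θ a)) ∧
      Finite θ.ker ∧ Finite (T ⧸ θ.range) := by
  subst hr
  -- the fibre condition in `•`-form
  have hfib : ∀ a : Submodule.torsionBy (PowerSeries ℤ_[p]) (Fin n → BigRepModule ℤ_[p] p (QpModZp p))
      (PowerSeries.X - PowerSeries.C c),
      (PowerSeries.X - PowerSeries.C c : PowerSeries ℤ_[p]) •
        (a : Fin n → BigRepModule ℤ_[p] p (QpModZp p)) = 0 := fun a ↦
    (Submodule.mem_torsionBy_iff _ _).mp a.2
  -- evaluation at `0`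
  let ev : Submodule.torsionBy (PowerSeries ℤ_[p]) (Fin n → BigRepModule ℤ_[p] p (QpModZp p))
      (PowerSeries.X - PowerSeries.C c) →+ (Fin n → QpModZp p) :=
    { toFun := fun a j ↦ (a : Fin n → BigRepModule ℤ_[p] p (QpModZp p)) j 0
      map_zero' := rfl
      map_add' := fun _ _ ↦ rfl }
  have hev : ∀ a j, ev a j = (a : Fin n → BigRepModule ℤ_[p] p (QpModZp p)) j 0 := fun _ _ ↦ rfl
  have hev_inj : Function.Injective ev := by
    intro a b hab
    exact Subtype.ext (eq_of_torsionBy_of_apply_zero_eq (hfib a) (hfib b) fun j ↦ by rw [← hev, ← hev, hab])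
  have hev_surj : Function.Surjective ev := by
    intro v
    obtain ⟨Ψ, hΨ, hΨ0⟩ := exists_of_torsionBy (𝒪 := ℤ_[p]) (n := n) hc (QpModZp.exists_pow_nsmul_eq_zero (p := p)) v
    exact ⟨⟨Ψ, (Submodule.mem_torsionBy_iff _ _).mpr hΨ⟩, funext fun j ↦ hΨ0 j⟩
  refine ⟨e.comp ev, fun c a ↦ ?_, fun σ a ↦ ?_, ?_, ?_⟩
  · -- semilinearity over `C`
    rw [AddMonoidHom.comp_apply, AddMonoidHom.comp_apply, ← he_lin]
    congr 1
    funext j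
    rw [hev, Pi.smul_apply, hev, Submodule.coe_smul, Pi.smul_apply, BigRepModule.C_smul, BigRepModule.smul_apply]
  · -- equivariance: the framed action on the fibre is the specialised matrix action
    rw [AddMonoidHom.comp_apply, AddMonoidHom.comp_apply, ← he_eq]
    congr 1
    funext i
    rw [hev, BigGaloisRep.torsionRep_apply_coe, matrixAction_apply_apply_of_eq_map_C_add ρ ρ₂ hρ₂ (hM σ) (hfib a)]
    rfl
  · -- finite kernel: `ev` is injective and maps `ker (e ∘ ev)` into `ker e`
    refine Finite.of_injective (fun a : (e.comp ev).ker ↦ (⟨ev a, ?_⟩ : e.ker)) fun a b hab ↦ ?_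
    · have := a.2
      rwa [AddMonoidHom.mem_ker, AddMonoidHom.comp_apply] at this
    · exact Subtype.ext (hev_inj (congrArg Subtype.val hab))
  · -- finite cokernel: `ev` is onto, so `range (e ∘ ev) = range e`
    have hrange : (e.comp ev).range = e.range := by
      refine le_antisymm (fun m ⟨a, ha⟩ ↦ ⟨ev a, ha⟩) fun m ⟨v, hv⟩ ↦ ?_
      obtain ⟨a, rfl⟩ := hev_surj v
      exact ⟨a, hv⟩
    rw [hrange]
    exact hcoker

/-! ## §3 N1 from N1♭-rem -/

set_option maxHeartbeats 1600000 in
/-- **Leaf N1 `stub_branchLattice` from N1♭-rem (by name, prefix-agnostic).** As `TelescopeBranchLatticeOfFramed.branchLattice_conclusion_of_framed`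
(road objects `W p N K κ 𝔭bar x D`, `‖x k‖ < 1`; framed `ρ : Γ_K →ₜ* GL (Fin 2) ℤ_p⟦X⟧`; (unr♭); (fd₀♭) through `constantCoeff`; ∀ k (rat_k)) but
with (fd_k♭) in remainder currency: `ρ σ = (M σ).map C + (X − C (x k)) • U σ` and `e : (ℚ_p/ℤ_p)² → A_{g_k}†` intertwining `M` with
`(D k).Δ.selfDualCofreeRepOver K` — THE CONCLUSION OF N1 HOLDS (v13c l.440–473 token for token).
[cite: Hida1986, Thm. 2.1 (2.2b) (2.2c)] [cite: Wiles1988, §2] [cite: Greenberg2006, p. 342 L4–11] -/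
theorem branchLattice_conclusion_of_framed_rem
    (W : WeierstrassCurve ℚ) [W.IsElliptic] [W.IsGloballyMinimal] (p : ℕ) [Fact p.Prime]
    (N : ℕ) (K : Type) [Field K] [NumberField K] (κ : ZpExtension K p) (𝔭bar : HeightOneSpectrum (𝓞 K))
    (x : ℕ → ℤ_[p]) (D : ℕ → Skinner2016.HidaCongruentForm W p 1) (hx : ∀ k, ‖x k‖ < 1)
    (τΛ : TopologicalSpace (PowerSeries ℤ_[p])) (hR : IsTopologicalRing (PowerSeries ℤ_[p]))
    (hΛ : ∀ k m : ℕ, IsOpen ((Ideal.span {PowerSeries.C ((p : ℤ_[p]) ^ k), (PowerSeries.X : PowerSeries ℤ_[p]) ^ m} :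
      Ideal (PowerSeries ℤ_[p])) : Set (PowerSeries ℤ_[p])))
    (ρ : FramedGaloisRep K (PowerSeries ℤ_[p]) 2)
    (hunr : ∃ S₀ : Set (HeightOneSpectrum (𝓞 K)), S₀.Finite ∧
      (∀ v ∉ S₀, ∀ 𝔓 ∈ v.primesAbove, ∀ σ ∈ 𝔓.inertia (Field.absoluteGaloisGroup K), ρ σ = 1) ∧
      ∀ w ∈ S₀, ((p : ℕ) : 𝓞 K) ∉ w.asIdeal → ((N : ℕ) : 𝓞 K) ∈ w.asIdeal)
    (hfd₀ : ∃ e₀ : (Fin 2 → QpModZp p) →+ PrimaryTorsion (W.baseChange K).geomPoints p,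
      (∀ (c : ℤ_[p]) (v : Fin 2 → QpModZp p), e₀ (c • v) = c • e₀ v) ∧
      (∀ (σ : Field.absoluteGaloisGroup K) (v : Fin 2 → QpModZp p),
        e₀ (fun i ↦ ∑ j, PowerSeries.constantCoeff
          (((ρ σ : GL (Fin 2) (PowerSeries ℤ_[p])) : Matrix (Fin 2) (Fin 2) (PowerSeries ℤ_[p])) i j) • v j) =
          (W.baseChange K).primaryTorsionGaloisRep p σ (e₀ v)) ∧
      Finite e₀.ker ∧ Finite (PrimaryTorsion (W.baseChange K).geomPoints p ⧸ e₀.range))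
    (hfd : ∀ k : ℕ, Function.Surjective (algebraMap ℤ_[p] (padicCoeffIntegers (D k).ι)) ∧
      ∃ (M : Field.absoluteGaloisGroup K → Matrix (Fin 2) (Fin 2) ℤ_[p])
        (U : Field.absoluteGaloisGroup K → Matrix (Fin 2) (Fin 2) (PowerSeries ℤ_[p])),
        (∀ σ : Field.absoluteGaloisGroup K, ((ρ σ : GL (Fin 2) (PowerSeries ℤ_[p])) : Matrix (Fin 2) (Fin 2) (PowerSeries ℤ_[p])) =
          (M σ).map (PowerSeries.C (R := ℤ_[p])) + (PowerSeries.X - PowerSeries.C (x k) : PowerSeries ℤ_[p]) • U σ) ∧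
      ∃ e : (Fin 2 → QpModZp p) →+ Cofree (D k).Δ.selfDualRep (padicCoeffField (D k).ι),
        (∀ (c : ℤ_[p]) (v : Fin 2 → QpModZp p), e (c • v) = algebraMap ℤ_[p] (padicCoeffIntegers (D k).ι) c • e v) ∧
        (∀ (σ : Field.absoluteGaloisGroup K) (v : Fin 2 → QpModZp p),
          e (fun i ↦ ∑ j, M σ i j • v j) = (D k).Δ.selfDualCofreeRepOver K σ (e v)) ∧
        Finite e.ker ∧ Finite (Cofree (D k).Δ.selfDualRep (padicCoeffField (D k).ι) ⧸ e.range)) :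
    ∃ (_ : TopologicalSpace (PowerSeries ℤ_[p])) (A₂ : Type) (_ : AddCommGroup A₂)
        (_ : Module (PowerSeries ℤ_[p]) A₂) (_ : TopologicalSpace A₂) (_ : DiscreteTopology A₂)
        (ρ₂ : ContinuousRep (Field.absoluteGaloisGroup K) (PowerSeries ℤ_[p]) A₂)
        (_ : TopologicalSpace (PowerSeries (PowerSeries ℤ_[p]))) (_ : IsTopologicalRing (PowerSeries (PowerSeries ℤ_[p])))
        (_ : ContinuousSMul (PowerSeries (PowerSeries ℤ_[p])) (BigRepModule (PowerSeries ℤ_[p]) p A₂))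
        (_ : Module (PowerSeries ℤ_[p]) (XBig κ ρ₂ 𝔭bar (∅ : Set (HeightOneSpectrum (𝓞 K)))))
        (_ : IsScalarTower (PowerSeries ℤ_[p]) (PowerSeries (PowerSeries ℤ_[p]))
          (XBig κ ρ₂ 𝔭bar (∅ : Set (HeightOneSpectrum (𝓞 K))))),
        (Literature.NumberTheory.IwasawaTheory.Greenberg2016.IsCofree (PowerSeries ℤ_[p]) A₂ ∧
          (∀ a : A₂, ∃ n : ℕ, (PowerSeries.X : PowerSeries ℤ_[p]) ^ n • a = 0) ∧
          (∀ a : A₂, ∃ b : A₂, (PowerSeries.X : PowerSeries ℤ_[p]) • b = a) ∧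
          (∀ (k : ℕ) (a : A₂), ∃ b : A₂, (PowerSeries.X - PowerSeries.C (x k)) • b = a) ∧
          (∃ S₀ : Set (HeightOneSpectrum (𝓞 K)), S₀.Finite ∧ GaloisRep.IsUnramifiedOutside S₀ ρ₂ ∧
            ∀ w ∈ S₀, ((p : ℕ) : 𝓞 K) ∉ w.asIdeal → ((N : ℕ) : 𝓞 K) ∈ w.asIdeal) ∧
          (∃ θ₀ : Submodule.torsionBy (PowerSeries ℤ_[p]) A₂ (PowerSeries.X : PowerSeries ℤ_[p]) →+
              PrimaryTorsion (W.baseChange K).geomPoints p,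
            (∀ (c : ℤ_[p]) (a : Submodule.torsionBy (PowerSeries ℤ_[p]) A₂ (PowerSeries.X : PowerSeries ℤ_[p])),
                θ₀ (PowerSeries.C c • a) = c • θ₀ a) ∧
            (∀ (σ : Field.absoluteGaloisGroup K)
                (a : Submodule.torsionBy (PowerSeries ℤ_[p]) A₂ (PowerSeries.X : PowerSeries ℤ_[p])),
                θ₀ (BigGaloisRep.torsionRep ρ₂ (PowerSeries.X : PowerSeries ℤ_[p]) σ a) =
                  (W.baseChange K).primaryTorsionGaloisRep p σ (θ₀ a)) ∧
            Finite θ₀.ker ∧ Finite (PrimaryTorsion (W.baseChange K).geomPoints p ⧸ θ₀.range)) ∧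
          (∀ k : ℕ, Function.Surjective (algebraMap ℤ_[p] (padicCoeffIntegers (D k).ι)) ∧
            ∃ θ : Submodule.torsionBy (PowerSeries ℤ_[p]) A₂ (PowerSeries.X - PowerSeries.C (x k)) →+
                Cofree (D k).Δ.selfDualRep (padicCoeffField (D k).ι),
              (∀ (c : ℤ_[p])
                  (a : Submodule.torsionBy (PowerSeries ℤ_[p]) A₂ (PowerSeries.X - PowerSeries.C (x k))),
                  θ (PowerSeries.C c • a) = algebraMap ℤ_[p] (padicCoeffIntegers (D k).ι) c • θ a) ∧
              (∀ (σ : Field.absoluteGaloisGroup K)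
                  (a : Submodule.torsionBy (PowerSeries ℤ_[p]) A₂ (PowerSeries.X - PowerSeries.C (x k))),
                  θ (BigGaloisRep.torsionRep ρ₂ (PowerSeries.X - PowerSeries.C (x k)) σ a) =
                    (D k).Δ.selfDualCofreeRepOver K σ (θ a)) ∧
              Finite θ.ker ∧ Finite (Cofree (D k).Δ.selfDualRep (padicCoeffField (D k).ι) ⧸ θ.range))) := by
  -- the cofree realisation of `ρ` (#1)
  obtain ⟨ρ₂, hρ₂, hker⟩ := exists_cofreeRealisation (n := 2) hΛ ρ
  -- the free instances of the witness: DISCRETE topology on `B = ℤ_p⟦X⟧⟦T⟧`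
  letI τB : TopologicalSpace (PowerSeries (PowerSeries ℤ_[p])) := ⊥
  haveI : DiscreteTopology (PowerSeries (PowerSeries ℤ_[p])) := ⟨rfl⟩
  haveI hB : IsTopologicalRing (PowerSeries (PowerSeries ℤ_[p])) :=
    { continuous_add := continuous_of_discreteTopology
      continuous_mul := continuous_of_discreteTopology
      continuous_neg := continuous_of_discreteTopology }
  -- the `Λ`-module structure on `X₂` through `Λ → B`
  letI mX : Module (PowerSeries ℤ_[p]) (XBig κ ρ₂ 𝔭bar (∅ : Set (HeightOneSpectrum (𝓞 K)))) :=
    Module.compHom _ (algebraMap (PowerSeries ℤ_[p]) (PowerSeries (PowerSeries ℤ_[p])))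
  have hST : IsScalarTower (PowerSeries ℤ_[p]) (PowerSeries (PowerSeries ℤ_[p]))
      (XBig κ ρ₂ 𝔭bar (∅ : Set (HeightOneSpectrum (𝓞 K)))) :=
    IsScalarTower.of_algebraMap_smul fun _ _ ↦ rfl
  refine ⟨τΛ, Fin 2 → BigRepModule ℤ_[p] p (QpModZp p), inferInstance, inferInstance, inferInstance, inferInstance, ρ₂, τB, hB,
    inferInstance, mX, hST, isCofree_pi, exists_X_pow_smul_eq_zero_pi, exists_X_smul_eq, fun k a ↦ exists_X_sub_C_smul_eq (x k) a,
    ?_, ?_, fun k ↦ ⟨(hfd k).1, ?_⟩⟩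
  · -- (unr)
    obtain ⟨S₀, hS₀f, hS₀u, hS₀N⟩ := hunr
    exact ⟨S₀, hS₀f, isUnramifiedOutside_of_framed ρ ρ₂ hker hS₀u, hS₀N⟩
  · -- (fd₀): the fibre at the point `constantCoeff` (`c = 0`)
    obtain ⟨e₀, he₀_lin, he₀_eq, he₀_ker, he₀_coker⟩ := hfd₀
    exact exists_fibreMap ρ ρ₂ hρ₂ PowerSeries.constantCoeff (fun r ↦ PowerSeries.constantCoeff_C r)
      (by rw [PowerSeries.constantCoeff_X]; exact dvd_zero _) X_sub_C_constantCoeff_X.symm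
      (fun c m ↦ c • m) (fun σ m ↦ (W.baseChange K).primaryTorsionGaloisRep p σ m) e₀ he₀_lin he₀_eq he₀_ker he₀_coker
  · -- (fd_k): the fibre at `x_k`, remainder currency
    obtain ⟨M, U, hM, e, he_lin, he_eq, he_ker, he_coker⟩ := (hfd k).2
    exact exists_fibreMap_rem ρ ρ₂ hρ₂ (dvd_of_norm_lt_one (hx k)) rfl M U hM
      (fun c m ↦ algebraMap ℤ_[p] (padicCoeffIntegers (D k).ι) c • m) (fun σ m ↦ (D k).Δ.selfDualCofreeRepOver K σ m)
      e he_lin he_eq he_ker he_coker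

set_option maxHeartbeats 1600000 in
/-- **N1 from N1♭-rem, ON THE REGISTERED TEXT.** Hypothesis = the v13c road prefix of `stub_branchLattice` (l.400–439, token for token) followed by
the framed lattice data with the member clause in remainder currency; conclusion = the v13c `stub_branchLattice` text (l.400–473) TOKEN FOR TOKEN.
A LEAD who registers this hypothesis as `stub_branchLatticeFramedRem` closes the N1 slot by `branchLattice_of_framed_rem stub_branchLatticeFramedRem`.
[cite: Hida1986, Thm. 2.1 (2.2b) (2.2c)] [cite: Wiles1988, §2] -/
theorem branchLattice_of_framed_rem
    (h :
        ∀ (W : WeierstrassCurve ℚ) [W.IsElliptic] [W.IsGloballyMinimal] (p : ℕ) [Fact p.Prime],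
    ∀ (N : ℕ) [NeZero N] (K : Type) [Field K] [NumberField K] (Dt : ModularParametrizationData W N)
      (H : HeegnerDatum N (NumberField.discr K)) (ιK : K →+* ℂ) (P : (W.baseChange K).toAffine.Point),
      CellC W p → W.conductorNorm ℤ = N →
      IsImaginaryQuadratic K → NumberField.discr K < -4 → SatisfiesHeegnerHypothesis N K →
      (W.quadraticTwist (NumberField.discr K : ℚ)).entireLFunction 1 ≠ 0 →
      WeierstrassCurve.Affine.Point.map ιK.toRatAlgHom P = heegnerPointComplex Dt H →
      ¬ (p : ℤ) ∣ Dt.c → ¬ IsOfFinAddOrder P →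
      Odd (NumberField.discr K) →
      ∀ (κ : ZpExtension K p), κ.IsAnticyclotomic →
        ∀ (γ : Field.absoluteGaloisGroup K) [Fact (κ.IsTopGenerator γ)]
          (𝔭 : HeightOneSpectrum (𝓞 K)), ((p : ℕ) : 𝓞 K) ∈ 𝔭.asIdeal →
          𝔭.asIdeal.ramificationIdx (𝓞 ℚ) = 1 → 𝔭.asIdeal.inertiaDeg (𝓞 ℚ) = 1 →
          ∀ (𝔭bar : HeightOneSpectrum (𝓞 K)), ((p : ℕ) : 𝓞 K) ∈ 𝔭bar.asIdeal → 𝔭bar ≠ 𝔭 →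
            ((Ideal.span {(p : ℤ)}).primesOver (𝓞 K)).ncard = 2 →
          ∀ (f : CuspForm (CongruenceSubgroup.Gamma0 N) 2), IsNewformOf W f →
            ∀ (ι' : PadicAlgCl p ≃+* ℂ),
              (∀ (w : InfinitePlace K) (k : 𝓞 K),
                k ∈ 𝔭.asIdeal ↔ ‖ι'.symm (w.embedding (k : K))‖ < 1) →
              ∀ (ΩK : ℂ) (Ωp : ℂ_[p]) (Q : PowerSeries 𝓞_ℂ_[p]), ΩK ≠ 0 → ‖Ωp‖ = 1 →
                R1.IsBDPLFunctionInt p ι' 𝔭 κ γ f ΩK Ωp Q →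
      ∀ (L : PowerSeries (PowerSeries (unrIntegers p))) (x : ℕ → ℤ_[p]) (D : ℕ → Skinner2016.HidaCongruentForm W p 1),
        (∀ k, ‖x k‖ < 1) ∧ Filter.Tendsto x Filter.atTop (nhds 0) ∧
        (∃ e : ℕ, PowerSeries.C ((p : 𝓞_ℂ_[p]) ^ e) * Q ∈
          Ideal.span {PowerSeries.map (R1.unrToCpInt p) (PowerSeries.map (PowerSeries.constantCoeff (R := unrIntegers p)) L)}) ∧
        (∀ k : ℕ, (∀ y : coeffField (D k).g, ι' ((D k).ι y) = (y : ℂ)) ∧ 2 * ((p : ℤ) - 1) ∣ (D k).k - 2 ∧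
          ∃ (ΩKg : ℂ) (Ωpg : ℂ_[p]) (Lg : UnrSeries p), ΩKg ≠ 0 ∧ ‖Ωpg‖ = 1 ∧
            IsBDPLFunctionWt ι' 𝔭 κ γ (D k).g ΩKg Ωpg Lg ∧
          ∃ Ψ : UnrSeries p,
            (∃ U : PowerSeries (PowerSeries (unrIntegers p)),
              PowerSeries.map (PowerSeries.C (R := unrIntegers p)) Ψ =
                L + PowerSeries.C (PowerSeries.X - PowerSeries.C (toUnr p (x k))) * U) ∧
            (∃ e : ℕ, PowerSeries.C ((p : 𝓞_ℂ_[p]) ^ e) * PowerSeries.map (R1.unrToCpInt p) Ψ ∈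
              Ideal.span {PowerSeries.map (R1.unrToCpInt p) Lg})) ∧
        (∃ A : ℕ → UnrSeries p, ∀ ℓ : ℕ, ℓ.Prime → ¬ ℓ ∣ N →
          (∃ U : UnrSeries p, A ℓ = PowerSeries.C (toUnr p ((W.frobeniusTrace ℓ : ℤ) : ℤ_[p])) + PowerSeries.X * U) ∧
          ∀ k : ℕ, ∃ (c : unrIntegers p) (U : UnrSeries p),
            A ℓ = PowerSeries.C c + (PowerSeries.X - PowerSeries.C (toUnr p (x k))) * U ∧
            ((c : ℂ_[p]) = algebraMap (PadicAlgCl p) ℂ_[p]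
              ((D k).ι ⟨(UpperHalfPlane.qExpansion 1 ⇑(D k).g).coeff ℓ, coeff_mem_coeffField (D k).g ℓ⟩))) →
      ∃ (_ : TopologicalSpace (PowerSeries ℤ_[p])) (_ : IsTopologicalRing (PowerSeries ℤ_[p]))
        (_ : ∀ k m : ℕ, IsOpen ((Ideal.span {PowerSeries.C ((p : ℤ_[p]) ^ k), (PowerSeries.X : PowerSeries ℤ_[p]) ^ m} :
          Ideal (PowerSeries ℤ_[p])) : Set (PowerSeries ℤ_[p])))
        (ρ : FramedGaloisRep K (PowerSeries ℤ_[p]) 2),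
        (∃ S₀ : Set (HeightOneSpectrum (𝓞 K)), S₀.Finite ∧
          (∀ v ∉ S₀, ∀ 𝔓 ∈ v.primesAbove, ∀ σ ∈ 𝔓.inertia (Field.absoluteGaloisGroup K), ρ σ = 1) ∧
          ∀ w ∈ S₀, ((p : ℕ) : 𝓞 K) ∉ w.asIdeal → ((N : ℕ) : 𝓞 K) ∈ w.asIdeal) ∧
        (∃ e₀ : (Fin 2 → QpModZp p) →+ PrimaryTorsion (W.baseChange K).geomPoints p,
          (∀ (c : ℤ_[p]) (v : Fin 2 → QpModZp p), e₀ (c • v) = c • e₀ v) ∧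
          (∀ (σ : Field.absoluteGaloisGroup K) (v : Fin 2 → QpModZp p),
            e₀ (fun i ↦ ∑ j, PowerSeries.constantCoeff
              (((ρ σ : GL (Fin 2) (PowerSeries ℤ_[p])) : Matrix (Fin 2) (Fin 2) (PowerSeries ℤ_[p])) i j) • v j) =
              (W.baseChange K).primaryTorsionGaloisRep p σ (e₀ v)) ∧
          Finite e₀.ker ∧ Finite (PrimaryTorsion (W.baseChange K).geomPoints p ⧸ e₀.range)) ∧
        (∀ k : ℕ, Function.Surjective (algebraMap ℤ_[p] (padicCoeffIntegers (D k).ι)) ∧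
          ∃ (M : Field.absoluteGaloisGroup K → Matrix (Fin 2) (Fin 2) ℤ_[p])
            (U : Field.absoluteGaloisGroup K → Matrix (Fin 2) (Fin 2) (PowerSeries ℤ_[p])),
            (∀ σ : Field.absoluteGaloisGroup K, ((ρ σ : GL (Fin 2) (PowerSeries ℤ_[p])) : Matrix (Fin 2) (Fin 2) (PowerSeries ℤ_[p])) =
              (M σ).map (PowerSeries.C (R := ℤ_[p])) + (PowerSeries.X - PowerSeries.C (x k) : PowerSeries ℤ_[p]) • U σ) ∧
          ∃ e : (Fin 2 → QpModZp p) →+ Cofree (D k).Δ.selfDualRep (padicCoeffField (D k).ι),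
            (∀ (c : ℤ_[p]) (v : Fin 2 → QpModZp p), e (c • v) = algebraMap ℤ_[p] (padicCoeffIntegers (D k).ι) c • e v) ∧
            (∀ (σ : Field.absoluteGaloisGroup K) (v : Fin 2 → QpModZp p),
              e (fun i ↦ ∑ j, M σ i j • v j) = (D k).Δ.selfDualCofreeRepOver K σ (e v)) ∧
            Finite e.ker ∧ Finite (Cofree (D k).Δ.selfDualRep (padicCoeffField (D k).ι) ⧸ e.range))) :
        ∀ (W : WeierstrassCurve ℚ) [W.IsElliptic] [W.IsGloballyMinimal] (p : ℕ) [Fact p.Prime],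
    ∀ (N : ℕ) [NeZero N] (K : Type) [Field K] [NumberField K] (Dt : ModularParametrizationData W N)
      (H : HeegnerDatum N (NumberField.discr K)) (ιK : K →+* ℂ) (P : (W.baseChange K).toAffine.Point),
      CellC W p → W.conductorNorm ℤ = N →
      IsImaginaryQuadratic K → NumberField.discr K < -4 → SatisfiesHeegnerHypothesis N K →
      (W.quadraticTwist (NumberField.discr K : ℚ)).entireLFunction 1 ≠ 0 →
      WeierstrassCurve.Affine.Point.map ιK.toRatAlgHom P = heegnerPointComplex Dt H →
      ¬ (p : ℤ) ∣ Dt.c → ¬ IsOfFinAddOrder P →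
      Odd (NumberField.discr K) →
      ∀ (κ : ZpExtension K p), κ.IsAnticyclotomic →
        ∀ (γ : Field.absoluteGaloisGroup K) [Fact (κ.IsTopGenerator γ)]
          (𝔭 : HeightOneSpectrum (𝓞 K)), ((p : ℕ) : 𝓞 K) ∈ 𝔭.asIdeal →
          𝔭.asIdeal.ramificationIdx (𝓞 ℚ) = 1 → 𝔭.asIdeal.inertiaDeg (𝓞 ℚ) = 1 →
          ∀ (𝔭bar : HeightOneSpectrum (𝓞 K)), ((p : ℕ) : 𝓞 K) ∈ 𝔭bar.asIdeal → 𝔭bar ≠ 𝔭 →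
            ((Ideal.span {(p : ℤ)}).primesOver (𝓞 K)).ncard = 2 →
          ∀ (f : CuspForm (CongruenceSubgroup.Gamma0 N) 2), IsNewformOf W f →
            ∀ (ι' : PadicAlgCl p ≃+* ℂ),
              (∀ (w : InfinitePlace K) (k : 𝓞 K),
                k ∈ 𝔭.asIdeal ↔ ‖ι'.symm (w.embedding (k : K))‖ < 1) →
              ∀ (ΩK : ℂ) (Ωp : ℂ_[p]) (Q : PowerSeries 𝓞_ℂ_[p]), ΩK ≠ 0 → ‖Ωp‖ = 1 →
                R1.IsBDPLFunctionInt p ι' 𝔭 κ γ f ΩK Ωp Q →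
      ∀ (L : PowerSeries (PowerSeries (unrIntegers p))) (x : ℕ → ℤ_[p]) (D : ℕ → Skinner2016.HidaCongruentForm W p 1),
        (∀ k, ‖x k‖ < 1) ∧ Filter.Tendsto x Filter.atTop (nhds 0) ∧
        (∃ e : ℕ, PowerSeries.C ((p : 𝓞_ℂ_[p]) ^ e) * Q ∈
          Ideal.span {PowerSeries.map (R1.unrToCpInt p) (PowerSeries.map (PowerSeries.constantCoeff (R := unrIntegers p)) L)}) ∧
        (∀ k : ℕ, (∀ y : coeffField (D k).g, ι' ((D k).ι y) = (y : ℂ)) ∧ 2 * ((p : ℤ) - 1) ∣ (D k).k - 2 ∧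
          ∃ (ΩKg : ℂ) (Ωpg : ℂ_[p]) (Lg : UnrSeries p), ΩKg ≠ 0 ∧ ‖Ωpg‖ = 1 ∧
            IsBDPLFunctionWt ι' 𝔭 κ γ (D k).g ΩKg Ωpg Lg ∧
          ∃ Ψ : UnrSeries p,
            (∃ U : PowerSeries (PowerSeries (unrIntegers p)),
              PowerSeries.map (PowerSeries.C (R := unrIntegers p)) Ψ =
                L + PowerSeries.C (PowerSeries.X - PowerSeries.C (toUnr p (x k))) * U) ∧
            (∃ e : ℕ, PowerSeries.C ((p : 𝓞_ℂ_[p]) ^ e) * PowerSeries.map (R1.unrToCpInt p) Ψ ∈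
              Ideal.span {PowerSeries.map (R1.unrToCpInt p) Lg})) ∧
        (∃ A : ℕ → UnrSeries p, ∀ ℓ : ℕ, ℓ.Prime → ¬ ℓ ∣ N →
          (∃ U : UnrSeries p, A ℓ = PowerSeries.C (toUnr p ((W.frobeniusTrace ℓ : ℤ) : ℤ_[p])) + PowerSeries.X * U) ∧
          ∀ k : ℕ, ∃ (c : unrIntegers p) (U : UnrSeries p),
            A ℓ = PowerSeries.C c + (PowerSeries.X - PowerSeries.C (toUnr p (x k))) * U ∧
            ((c : ℂ_[p]) = algebraMap (PadicAlgCl p) ℂ_[p]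
              ((D k).ι ⟨(UpperHalfPlane.qExpansion 1 ⇑(D k).g).coeff ℓ, coeff_mem_coeffField (D k).g ℓ⟩))) →
      ∃ (_ : TopologicalSpace (PowerSeries ℤ_[p])) (A₂ : Type) (_ : AddCommGroup A₂)
        (_ : Module (PowerSeries ℤ_[p]) A₂) (_ : TopologicalSpace A₂) (_ : DiscreteTopology A₂)
        (ρ₂ : ContinuousRep (Field.absoluteGaloisGroup K) (PowerSeries ℤ_[p]) A₂)
        (_ : TopologicalSpace (PowerSeries (PowerSeries ℤ_[p]))) (_ : IsTopologicalRing (PowerSeries (PowerSeries ℤ_[p])))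
        (_ : ContinuousSMul (PowerSeries (PowerSeries ℤ_[p])) (BigRepModule (PowerSeries ℤ_[p]) p A₂))
        (_ : Module (PowerSeries ℤ_[p]) (XBig κ ρ₂ 𝔭bar (∅ : Set (HeightOneSpectrum (𝓞 K)))))
        (_ : IsScalarTower (PowerSeries ℤ_[p]) (PowerSeries (PowerSeries ℤ_[p]))
          (XBig κ ρ₂ 𝔭bar (∅ : Set (HeightOneSpectrum (𝓞 K))))),
        (Literature.NumberTheory.IwasawaTheory.Greenberg2016.IsCofree (PowerSeries ℤ_[p]) A₂ ∧
          (∀ a : A₂, ∃ n : ℕ, (PowerSeries.X : PowerSeries ℤ_[p]) ^ n • a = 0) ∧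
          (∀ a : A₂, ∃ b : A₂, (PowerSeries.X : PowerSeries ℤ_[p]) • b = a) ∧
          (∀ (k : ℕ) (a : A₂), ∃ b : A₂, (PowerSeries.X - PowerSeries.C (x k)) • b = a) ∧
          (∃ S₀ : Set (HeightOneSpectrum (𝓞 K)), S₀.Finite ∧ GaloisRep.IsUnramifiedOutside S₀ ρ₂ ∧
            ∀ w ∈ S₀, ((p : ℕ) : 𝓞 K) ∉ w.asIdeal → ((N : ℕ) : 𝓞 K) ∈ w.asIdeal) ∧
          (∃ θ₀ : Submodule.torsionBy (PowerSeries ℤ_[p]) A₂ (PowerSeries.X : PowerSeries ℤ_[p]) →+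
              PrimaryTorsion (W.baseChange K).geomPoints p,
            (∀ (c : ℤ_[p]) (a : Submodule.torsionBy (PowerSeries ℤ_[p]) A₂ (PowerSeries.X : PowerSeries ℤ_[p])),
                θ₀ (PowerSeries.C c • a) = c • θ₀ a) ∧
            (∀ (σ : Field.absoluteGaloisGroup K)
                (a : Submodule.torsionBy (PowerSeries ℤ_[p]) A₂ (PowerSeries.X : PowerSeries ℤ_[p])),
                θ₀ (BigGaloisRep.torsionRep ρ₂ (PowerSeries.X : PowerSeries ℤ_[p]) σ a) =
                  (W.baseChange K).primaryTorsionGaloisRep p σ (θ₀ a)) ∧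
            Finite θ₀.ker ∧ Finite (PrimaryTorsion (W.baseChange K).geomPoints p ⧸ θ₀.range)) ∧
          (∀ k : ℕ, Function.Surjective (algebraMap ℤ_[p] (padicCoeffIntegers (D k).ι)) ∧
            ∃ θ : Submodule.torsionBy (PowerSeries ℤ_[p]) A₂ (PowerSeries.X - PowerSeries.C (x k)) →+
                Cofree (D k).Δ.selfDualRep (padicCoeffField (D k).ι),
              (∀ (c : ℤ_[p])
                  (a : Submodule.torsionBy (PowerSeries ℤ_[p]) A₂ (PowerSeries.X - PowerSeries.C (x k))),
                  θ (PowerSeries.C c • a) = algebraMap ℤ_[p] (padicCoeffIntegers (D k).ι) c • θ a) ∧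
              (∀ (σ : Field.absoluteGaloisGroup K)
                  (a : Submodule.torsionBy (PowerSeries ℤ_[p]) A₂ (PowerSeries.X - PowerSeries.C (x k))),
                  θ (BigGaloisRep.torsionRep ρ₂ (PowerSeries.X - PowerSeries.C (x k)) σ a) =
                    (D k).Δ.selfDualCofreeRepOver K σ (θ a)) ∧
              Finite θ.ker ∧ Finite (Cofree (D k).Δ.selfDualRep (padicCoeffField (D k).ι) ⧸ θ.range))) := by
  intro W _ _ p _ N _ K _ _ Dt H ιK P hC hN hK hdisc hH hL1 hP hc hPinf hodd κ hκ γ _ 𝔭 h𝔭 hram hdeg 𝔭bar h𝔭bar hne hsplit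
    f hf ι' hι' ΩK Ωp Q hΩK hΩp hQ L x D hpkg
  obtain ⟨τΛ, hR, hΛ, ρ, hunr, hfd₀, hfd⟩ := h W p N K Dt H ιK P hC hN hK hdisc hH hL1 hP hc hPinf hodd κ hκ γ 𝔭 h𝔭 hram hdeg
    𝔭bar h𝔭bar hne hsplit f hf ι' hι' ΩK Ωp Q hΩK hΩp hQ L x D hpkg
  exact branchLattice_conclusion_of_framed_rem W p N K κ 𝔭bar x D hpkg.1 τΛ hR hΛ ρ hunr hfd₀ hfd

end Summit.BirchSwinnertonDyer.BirchSwinnertonDyer.Theorems.TelescopeBranchLatticeOfFramedRem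
end
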